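import Summits.Ventures.LatticeQCDFlow.Scoring.InfiniteVolumeIndependence2D
import HarnessLib

/-!
# The exact non-abelian area law in two dimensions, V-v: the Osterwalder–Seiler strong-coupling conclusions (i)–(iii) hold at EVERY coupling in `d = 2`

HONEST FRAMING: exact (Metropolis-corrected) sampling algorithms for lattice gauge theory;
figures of merit are autocorrelation/cost numbers at stated couplings and volumes; no
continuum-physics claim.

Venture `LatticeQCDFlow` (cell pub-lqcd), sub-topic `Scoring`; FANOUT row 5 (`s0-sun-a`), GEN-22.
NEW WORK of the cell (placement rule).  `Literature…LatticeGauge.osterwalder_seiler_strongCoupling d ρ` records, for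
`0 ≤ β < β₀(G, ρ, d)`: (i) `HasUniqueInfiniteVolumeLimit ρ β`; (ii) translation invariance of every limit point;
(iii) exponential clustering `HasExponentialDecayRate (x ↦ cov_μ(F₁, F₂ ∘ θ_x)) m` of bounded measurable
gauge-invariant local observables for some `m`; (iv) analyticity of local expectations on `(−β₀, β₀)` — proved in the
tree for every `d ≥ 2` by the cluster expansion.  This file packages the row-5 results for `d = 2`:

* **`osterwalder_seiler_conclusions_two`** — for every compact metrisable `G`, continuous `ρ` and EVERY real `β`:
  (i) (part V-k `hasUniqueInfiniteVolumeLimit_two`), (ii) (`isZdTranslationInvariant_of_mem_two`), and (iii) FOR EVERY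
  `m > 0` AND ALL bounded measurable local observables — gauge invariance not needed (part V-u
  `hasExponentialDecayRate_covariance_two_measurable`).  (iv) at every `β` is part V-q `InfiniteVolumeAnalytic2D`
  (analyticity on all of `ℝ`, continuous observables), filed separately.

No `def`, nothing cited as a fact, 0 sorry.
-/

noncomputable section

open MeasureTheory ProbabilityTheory Function Finset Filter Topology
open Literature.MathematicalPhysics.QuantumFieldTheory
open Literature.MathematicalPhysics.QuantumLattice
open Summit.Ventures.LatticeQCDFlow.Theory2.Lattice
open Summit.Ventures.LatticeQCDFlow.Theory2.Lattice.TwoDim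

namespace Summit.Ventures.LatticeQCDFlow.Scoring

variable {G : Type*} [Group G] [TopologicalSpace G] [IsTopologicalGroup G]
  [CompactSpace G] [T2Space G] [SecondCountableTopology G] [MeasurableSpace G] [BorelSpace G] {N : ℕ}
  (ρ : G →* Matrix (Fin N) (Fin N) ℂ)

/-- **THE OSTERWALDER–SEILER STRONG-COUPLING CONCLUSIONS (i)–(iii) AT EVERY COUPLING IN TWO DIMENSIONS.**  For every
compact metrisable gauge group `G`, every continuous representation `ρ` and EVERY real `β`: the infinite-volume limit
of the torus Wilson states exists and is unique, every limit point is translation invariant, and for EVERY `m > 0` the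
covariances of ALL bounded measurable local observables decay (indeed vanish beyond the supports' sizes) at rate `m`:
`HasExponentialDecayRate (x ↦ cov_μ(F₁, F₂ ∘ θ_x)) m`.  Compare `Literature…osterwalder_seiler_strongCoupling` (`d ≥ 2`,
`0 ≤ β < β₀`, gauge-invariant observables, some `m(β)`). -/
theorem osterwalder_seiler_conclusions_two (hρ : Continuous ρ) (β : ℝ) :
    HasUniqueInfiniteVolumeLimit (d := 2) ρ β ∧
      ∀ μ ∈ infiniteVolumeLimitPoints (d := 2) ρ β,
        IsZdTranslationInvariant μ ∧
          ∀ m : ℝ, 0 < m → ∀ F₁ F₂ : LGConfig 2 G → ℝ,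
            Literature.MathematicalPhysics.QuantumLattice.IsLocalObservable F₁ →
            Literature.MathematicalPhysics.QuantumLattice.IsLocalObservable F₂ →
            Measurable F₁ → Measurable F₂ → (∃ C, ∀ U, |F₁ U| ≤ C) → (∃ C, ∀ U, |F₂ U| ≤ C) →
              Literature.Probability.LatticeModels.HasExponentialDecayRate
                (fun x : Literature.Probability.LatticeModels.Site 2 =>
                  cov[F₁, fun U => F₂ (configShift x U); μ]) m :=
  ⟨hasUniqueInfiniteVolumeLimit_two ρ hρ β, fun _μ hμ =>
    ⟨isZdTranslationInvariant_of_mem_two ρ hρ hμ, fun _m hm _F₁ _F₂ hF₁ hF₂ hm₁ hm₂ hb₁ hb₂ =>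
      hasExponentialDecayRate_covariance_two_measurable ρ hρ hμ hm hF₁ hF₂ hm₁ hm₂ hb₁ hb₂⟩⟩

/-- In particular the gauge-invariant clause (iii) of `osterwalder_seiler_strongCoupling`, verbatim in its hypotheses, at
every `β` in `d = 2` (gauge invariance is simply not used). -/
theorem hasExponentialDecayRate_covariance_two_gaugeInvariant (hρ : Continuous ρ) {β : ℝ}
    {μ : Measure (LGConfig 2 G)} (hμ : μ ∈ infiniteVolumeLimitPoints ρ β) {m : ℝ} (hm : 0 < m)
    (F₁ F₂ : LGConfig 2 G → ℝ) (hF₁ : Literature.MathematicalPhysics.QuantumLattice.IsLocalObservable F₁)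
    (hF₂ : Literature.MathematicalPhysics.QuantumLattice.IsLocalObservable F₂) (hm₁ : Measurable F₁)
    (hm₂ : Measurable F₂) (hb₁ : ∃ C, ∀ U, |F₁ U| ≤ C) (hb₂ : ∃ C, ∀ U, |F₂ U| ≤ C)
    (_h₁ : IsZdGaugeInvariant F₁) (_h₂ : IsZdGaugeInvariant F₂) :
    Literature.Probability.LatticeModels.HasExponentialDecayRate
      (fun x : Literature.Probability.LatticeModels.Site 2 => cov[F₁, fun U => F₂ (configShift x U); μ]) m :=
  hasExponentialDecayRate_covariance_two_measurable ρ hρ hμ hm hF₁ hF₂ hm₁ hm₂ hb₁ hb₂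

end Summit.Ventures.LatticeQCDFlow.Scoring
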